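import Summits.ValiantsHypothesis.ValiantsHypothesis.Theorems.GrenetZeonDualUnipotentThreeHalvesHeavyTopShiftSandwich

/-!
# `GrenetZeon.DualUnipotentThreeHalves` (stmt-ValiantsHypothesis-24318) — P-Q1 kernel port (lead-g2 `P-Q1-LEVEL2-PORTMAP.md` L2.4 / (D)):
# THE (E2) IDENTITY, EVALUATED: the one-`Ê`-one-`ŵ` words of `(A + zÊ + xŵ)^s` at the entry `(0, s−1)` sum to `g_q + tr τ`

Experiment cell «val-heavytop-census» (D-0160), engine seat val-htc-eng-1 (g3), kit 0; split of record (lead g3 03:00:55Z): eng-1 g3 types L2.3/L2.4.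
Conventions of the bricks (`Fin (s+1)`, `ω = Fin.last s`, shift `A` via `hA`, matrix units `E_{pq} = vecMulVec (Pi.single p 1) (Pi.single q 1)`);
letters of the Level-2 chart (port map (B)): `ŵ = E_{ω,q+1} + τ + γ_{q+1}`, `Ê = E_{01} + γ`.

* §1 word shapes at `(0, s−1)`: `word1_apply` (`(A^a X A^c Y A^d)_{0,s−1} = (X A^c Y)_{a, a+c+1}`), `word2_apply` (`(A^i Y (A^b X A^d))_{0,s−1} = (Y A^b X)_{i,i+b+1}`).
* §2 middle letters: `unit01_mul_shift_pow_mul_apply` (`(E_{01} A^c Y)_{a,y} = [a=0] Y_{1+c,y}`), `colLast_mul_shift_pow_mul_apply` (`(γ A^c Y)_{a,y} = γ_{aω}[c=0]Y_{ωy}`),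
  `mul_shift_pow_mul_unit01_apply` (`(Y A^b E_{01})_{x,y'} = [y'=1][b=0] Y_{x0}`), `mul_shift_pow_mul_colLast_apply` (`(Y A^b γ)_{x,y'} = 0`, `y' ≠ ω`).
* §3 on the chart letters: `what_diag`, `what_row_last`, `what_zero_zero`; ★ `word1_eval` (type-1 words `A^a Ê A^{i−1−a} ŵ A^{s−1−i}` ↦
  `[a=0] τ_{ii} + [a=i−1 ∧ i=q+1] γ_{qω}`), ★ `word2_eval` (type-2 words `A^i ŵ A^b Ê A^{s−2−i−b}` ↦ `[i=0 ∧ b=0] τ_{00}`).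
* §4 ★★ `E2_identity` — for `τ` with zero row `ω`, `γ_{q+1}, γ` supported in column `ω`, `q + 2 ≤ s`:
  `(Σ_{i<s} ((Σ_{a<i} A^a Ê A^{i−1−a}) ŵ A^{s−1−i} + A^i ŵ Σ_{b<s−1−i} A^b Ê A^{s−1−i−1−b}))_{0,s−1} = γ_{q,ω} + tr τ` — the matrix on the left is LITERALLY the
  sum of eng-2 g3's ✓ `…HeavyTopLevelTwoTools.mixed_eq_zero (A) (Ê) (ŵ) (s)` (which says it is `0` when `(A + zÊ + xŵ)^s = 0` for all `x, z`), so in a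
  space with nilindex `≤ s` containing `A, Ê, ŵ`: **`g_q + tr τ_{q+1} = 0`**, and with the chart's `tr τ_{q+1} = 0` (trace-free complement `𝒞₀`): `g_q = 0`
  — (E2) of Q1-PROOF §2 in the kernel, for every `s`.  Contributing words exactly as in port map (D): `E_{01} A^{i−1} τ A^{s−1−i}` (`τ_{ii}`),
  `τ E_{01} A^{s−2}` (`τ_{00}`), `A^q γ E_{ω,q+1} A^{s−2−q}` (`g_q`); all other letter pairs vanish entrywise.

Pure matrix algebra; ι(7), (5,7), R2, 24318 OPEN / not moved; VP ≠ VNP NOT proved.  `--supports stmt-ValiantsHypothesis-24318 --as helper`.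
No definitions, no named facts. [lead-g2 Q1-PROOF §2 (E2); `P-Q1-LEVEL2-PORTMAP.md` (B), (C) L2.4, (D); this seat]
-/

set_option linter.dupNamespace false
set_option autoImplicit false

namespace Summit.ValiantsHypothesis.ValiantsHypothesis.Theorems.GrenetZeon.HeavyTopE2Identity

open Matrix
open scoped BigOperators
open Summit.ValiantsHypothesis.ValiantsHypothesis.Theorems.GrenetZeon.HeavyTopBorderShift (shift_pow_succ_apply)
open Summit.ValiantsHypothesis.ValiantsHypothesis.Theorems.GrenetZeon.HeavyTopShiftSandwich

variable {s : ℕ}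

/-- Entries of a matrix unit `E_{pq} = e_p e_qᵀ` (as in ✓ `…HeavyTopE1Identity.unit_apply`). -/
private theorem unit_apply {n : Type*} [DecidableEq n] (p q i j : n) :
    vecMulVec (Pi.single p (1 : ℂ)) (Pi.single q (1 : ℂ)) i j = if i = p ∧ j = q then 1 else 0 := by
  simp only [vecMulVec_apply, Pi.single_apply]
  split_ifs <;> simp_all

/-! ## §1 The two word shapes at the entry `(0, s−1)` -/

/-- **Type-1 word** (`Ê` before `ŵ`): for `a + c + d = s − 2`, `(A^a X A^c · Y · A^d)_{0,s−1} = (X A^c Y)_{a, s−1−d}` and `s − 1 − d = a + c + 1`.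
[this file] -/
theorem word1_apply (A : Matrix (Fin (s + 1)) (Fin (s + 1)) ℂ)
    (hA : ∀ i j : Fin (s + 1), A i j = if (j : ℕ) = i + 1 ∧ (j : ℕ) < s then 1 else 0) (X Y : Matrix (Fin (s + 1)) (Fin (s + 1)) ℂ)
    (a c d : ℕ) (hacd : a + c + d = s - 2) (hs : 2 ≤ s) :
    (A ^ a * X * A ^ c * Y * A ^ d) 0 ⟨s - 1, by omega⟩ = (X * A ^ c * Y) ⟨a, by omega⟩ ⟨a + c + 1, by omega⟩ := by
  rw [mul_shift_pow_apply A hA _ d 0 _ (by simp only; omega), dif_pos (by simp only; omega),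
    show A ^ a * X * A ^ c * Y = A ^ a * (X * A ^ c * Y) by simp only [Matrix.mul_assoc],
    shift_pow_mul_apply A hA _ a 0 _ (by simp only [Fin.val_zero]; omega), dif_pos (by simp only [Fin.val_zero]; omega)]
  exact congrArg₂ (X * A ^ c * Y) (Fin.ext (by simp)) (Fin.ext (by simp only; omega))

/-- **Type-2 word** (`ŵ` before `Ê`): for `i + b + d = s − 2`, `(A^i · Y · A^b X A^d)_{0,s−1} = (Y A^b X)_{i, i+b+1}`. [this file] -/
theorem word2_apply (A : Matrix (Fin (s + 1)) (Fin (s + 1)) ℂ)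
    (hA : ∀ i j : Fin (s + 1), A i j = if (j : ℕ) = i + 1 ∧ (j : ℕ) < s then 1 else 0) (X Y : Matrix (Fin (s + 1)) (Fin (s + 1)) ℂ)
    (i b d : ℕ) (hibd : i + b + d = s - 2) (hs : 2 ≤ s) :
    (A ^ i * Y * (A ^ b * X * A ^ d)) 0 ⟨s - 1, by omega⟩ = (Y * A ^ b * X) ⟨i, by omega⟩ ⟨i + b + 1, by omega⟩ := by
  rw [show A ^ i * Y * (A ^ b * X * A ^ d) = A ^ i * (Y * A ^ b * X) * A ^ d by simp only [Matrix.mul_assoc],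
    mul_shift_pow_apply A hA _ d 0 _ (by simp only; omega), dif_pos (by simp only; omega),
    shift_pow_mul_apply A hA _ i 0 _ (by simp only [Fin.val_zero]; omega), dif_pos (by simp only [Fin.val_zero]; omega)]
  exact congrArg₂ (Y * A ^ b * X) (Fin.ext (by simp)) (Fin.ext (by simp only; omega))

/-! ## §2 The middle letters -/

/-- `(E_{01} · A^c · Y)_{a,y} = [a = 0] · Y_{1+c, y}` (`0` if `1 + c ≥ s`). [this file] -/
theorem unit01_mul_shift_pow_mul_apply (hs : 2 ≤ s) (A : Matrix (Fin (s + 1)) (Fin (s + 1)) ℂ)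
    (hA : ∀ i j : Fin (s + 1), A i j = if (j : ℕ) = i + 1 ∧ (j : ℕ) < s then 1 else 0) (Y : Matrix (Fin (s + 1)) (Fin (s + 1)) ℂ)
    (c : ℕ) (a y : Fin (s + 1)) :
    (vecMulVec (Pi.single (0 : Fin (s + 1)) (1 : ℂ)) (Pi.single (⟨1, by omega⟩ : Fin (s + 1)) (1 : ℂ)) * A ^ c * Y) a y =
      if a = 0 then (if h : 1 + c < s then Y ⟨1 + c, by omega⟩ y else 0) else 0 := by
  rw [Matrix.mul_assoc, Matrix.mul_apply, Finset.sum_eq_single (⟨1, by omega⟩ : Fin (s + 1))]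
  · rw [unit_apply]
    by_cases ha : a = 0
    · rw [if_pos ⟨ha, rfl⟩, one_mul, if_pos ha, shift_pow_mul_apply A hA Y c _ y (by simp only; omega)]
    · rw [if_neg (fun h => ha h.1), zero_mul, if_neg ha]
  · intro l _ hl
    rw [unit_apply, if_neg (fun h => hl h.2), zero_mul]
  · intro h'
    exact absurd (Finset.mem_univ _) h'

/-- `(γ · A^c · Y)_{a,y} = γ_{a,ω} · [c = 0] · Y_{ω,y}` for `γ` supported in column `ω`. [this file] -/
theorem colLast_mul_shift_pow_mul_apply (A : Matrix (Fin (s + 1)) (Fin (s + 1)) ℂ)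
    (hA : ∀ i j : Fin (s + 1), A i j = if (j : ℕ) = i + 1 ∧ (j : ℕ) < s then 1 else 0) (γ Y : Matrix (Fin (s + 1)) (Fin (s + 1)) ℂ)
    (hγ : ∀ p r, r ≠ Fin.last s → γ p r = 0) (c : ℕ) (a y : Fin (s + 1)) :
    (γ * A ^ c * Y) a y = γ a (Fin.last s) * (if c = 0 then Y (Fin.last s) y else 0) := by
  rw [Matrix.mul_assoc, Matrix.mul_apply, Finset.sum_eq_single (Fin.last s)]
  · congr 1
    rcases Nat.eq_zero_or_pos c with rfl | hc
    · rw [pow_zero, Matrix.one_mul, if_pos rfl]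
    · obtain ⟨c', rfl⟩ : ∃ c', c = c' + 1 := ⟨c - 1, by omega⟩
      rw [shift_pow_succ_mul_apply_last A hA Y c' y, if_neg (by omega)]
  · intro l _ hl
    rw [hγ a l hl, zero_mul]
  · intro h'
    exact absurd (Finset.mem_univ _) h'

/-- `(Y · A^b · E_{01})_{x,y'} = [y' = 1] · [b = 0] · Y_{x,0}`. [this file] -/
theorem mul_shift_pow_mul_unit01_apply (hs : 2 ≤ s) (A : Matrix (Fin (s + 1)) (Fin (s + 1)) ℂ)
    (hA : ∀ i j : Fin (s + 1), A i j = if (j : ℕ) = i + 1 ∧ (j : ℕ) < s then 1 else 0) (Y : Matrix (Fin (s + 1)) (Fin (s + 1)) ℂ)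
    (b : ℕ) (x y' : Fin (s + 1)) :
    (Y * A ^ b * vecMulVec (Pi.single (0 : Fin (s + 1)) (1 : ℂ)) (Pi.single (⟨1, by omega⟩ : Fin (s + 1)) (1 : ℂ))) x y' =
      if y' = ⟨1, by omega⟩ ∧ b = 0 then Y x 0 else 0 := by
  rw [Matrix.mul_apply, Finset.sum_eq_single (0 : Fin (s + 1))]
  · rw [unit_apply, mul_shift_pow_apply A hA Y b x 0 (by simp only [Fin.val_zero]; omega)]
    by_cases hy : y' = ⟨1, by omega⟩
    · rw [if_pos ⟨rfl, hy⟩, mul_one]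
      by_cases hb : b = 0
      · subst hb
        rw [dif_pos (by simp), if_pos ⟨hy, rfl⟩]
        exact congrArg (Y x) (Fin.ext (by simp))
      · rw [dif_neg (by simp only [Fin.val_zero]; omega), if_neg (fun h => hb h.2)]
    · rw [if_neg (fun h => hy h.2), mul_zero, if_neg (fun h => hy h.1)]
  · intro l _ hl
    rw [unit_apply, if_neg (fun h => hl h.1), mul_zero]
  · intro h'
    exact absurd (Finset.mem_univ _) h'

/-- `(Y · A^b · γ)_{x,y'} = 0` for `y' ≠ ω` when `γ` is supported in column `ω`. [this file] -/
theorem mul_shift_pow_mul_colLast_apply (A : Matrix (Fin (s + 1)) (Fin (s + 1)) ℂ) (γ Y : Matrix (Fin (s + 1)) (Fin (s + 1)) ℂ)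
    (hγ : ∀ p r, r ≠ Fin.last s → γ p r = 0) (b : ℕ) (x y' : Fin (s + 1)) (hy : y' ≠ Fin.last s) :
    (Y * A ^ b * γ) x y' = 0 := by
  rw [Matrix.mul_apply]
  exact Finset.sum_eq_zero fun l _ => by rw [hγ l y' hy, mul_zero]

/-! ## §3 The two word families, evaluated on the chart letters -/

section Chart

variable (hs : 2 ≤ s) (A : Matrix (Fin (s + 1)) (Fin (s + 1)) ℂ)
  (hA : ∀ i j : Fin (s + 1), A i j = if (j : ℕ) = i + 1 ∧ (j : ℕ) < s then 1 else 0)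
  (q : ℕ) (hq : q + 2 ≤ s) (τ γj γ : Matrix (Fin (s + 1)) (Fin (s + 1)) ℂ)
  (hτrow : ∀ l, τ (Fin.last s) l = 0) (hγj : ∀ p r, r ≠ Fin.last s → γj p r = 0) (hγ : ∀ p r, r ≠ Fin.last s → γ p r = 0)

include hγj in
/-- The diagonal block entries of `ŵ = E_{ω,q+1} + τ + γⱼ` are those of `τ`. -/
theorem what_diag (i : ℕ) (hi : i < s) :
    (vecMulVec (Pi.single (Fin.last s) (1 : ℂ)) (Pi.single (⟨q + 1, by omega⟩ : Fin (s + 1)) (1 : ℂ)) + τ + γj) ⟨i, by omega⟩ ⟨i, by omega⟩ =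
      τ ⟨i, by omega⟩ ⟨i, by omega⟩ := by
  have hiω : (⟨i, by omega⟩ : Fin (s + 1)) ≠ Fin.last s := fun h => by
    have := congrArg Fin.val h; simp at this; omega
  rw [Matrix.add_apply, Matrix.add_apply, unit_apply, if_neg (fun h => hiω h.1), zero_add, hγj _ _ hiω, add_zero]

include hτrow hγj in
/-- Row `ω` of `ŵ` at a block column `i` is `[i = q+1]`. -/
theorem what_row_last (i : ℕ) (hi : i < s) :
    (vecMulVec (Pi.single (Fin.last s) (1 : ℂ)) (Pi.single (⟨q + 1, by omega⟩ : Fin (s + 1)) (1 : ℂ)) + τ + γj) (Fin.last s) ⟨i, by omega⟩ =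
      if i = q + 1 then 1 else 0 := by
  have hiω : (⟨i, by omega⟩ : Fin (s + 1)) ≠ Fin.last s := fun h => by
    have := congrArg Fin.val h; simp at this; omega
  rw [Matrix.add_apply, Matrix.add_apply, unit_apply, hτrow, hγj _ _ hiω, add_zero, add_zero]
  by_cases h : i = q + 1
  · rw [if_pos ⟨rfl, Fin.ext (by simp only; omega)⟩, if_pos h]
  · rw [if_neg (fun h' => h (by have := congrArg Fin.val h'.2; simpa using this)), if_neg h]

include hγj in
/-- The corner entry of `ŵ` is `τ_{00}`. -/
theorem what_zero_zero :
    (vecMulVec (Pi.single (Fin.last s) (1 : ℂ)) (Pi.single (⟨q + 1, by omega⟩ : Fin (s + 1)) (1 : ℂ)) + τ + γj) 0 0 = τ 0 0 := by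
  have h0ω : (0 : Fin (s + 1)) ≠ Fin.last s := fun h => by
    have := congrArg Fin.val h; simp at this; omega
  rw [Matrix.add_apply, Matrix.add_apply, unit_apply, if_neg (fun h => h0ω h.1), zero_add, hγj _ _ h0ω, add_zero]

include hs hA hq hτrow hγj hγ

/-- **Type-1 words on the chart letters**: for `a < i < s`,
`(A^a Ê A^{i−1−a} ŵ A^{s−1−i})_{0,s−1} = [a = 0]·τ_{ii} + [a = i−1 ∧ i = q+1]·γ_{q,ω}`
(`ŵ = E_{ω,q+1} + τ + γⱼ`, `Ê = E_{01} + γ`). [this file] -/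
theorem word1_eval (i a : ℕ) (hi : i < s) (ha : a < i) :
    (A ^ a * (vecMulVec (Pi.single (0 : Fin (s + 1)) (1 : ℂ)) (Pi.single (⟨1, by omega⟩ : Fin (s + 1)) (1 : ℂ)) + γ) *
        A ^ (i - 1 - a) * (vecMulVec (Pi.single (Fin.last s) (1 : ℂ)) (Pi.single (⟨q + 1, by omega⟩ : Fin (s + 1)) (1 : ℂ)) + τ + γj) *
        A ^ (s - 1 - i)) 0 ⟨s - 1, by omega⟩ =
      (if a = 0 then τ ⟨i, by omega⟩ ⟨i, by omega⟩ else 0) + (if a = i - 1 ∧ i = q + 1 then γ ⟨q, by omega⟩ (Fin.last s) else 0) := by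
  rw [word1_apply A hA _ _ a (i - 1 - a) (s - 1 - i) (by omega) hs]
  have hidx : (⟨a + (i - 1 - a) + 1, by omega⟩ : Fin (s + 1)) = ⟨i, by omega⟩ := Fin.ext (by simp only; omega)
  rw [hidx, Matrix.add_mul, Matrix.add_mul, Matrix.add_apply, unit01_mul_shift_pow_mul_apply hs A hA,
    colLast_mul_shift_pow_mul_apply A hA γ _ hγ, what_row_last q hq τ γj hτrow hγj i hi]
  congr 1
  · by_cases ha0 : a = 0
    · subst ha0
      have e0 : (⟨0, by omega⟩ : Fin (s + 1)) = 0 := rfl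
      rw [e0, if_pos rfl, if_pos rfl, dif_pos (by omega)]
      have hidx2 : (⟨1 + (i - 1 - 0), by omega⟩ : Fin (s + 1)) = ⟨i, by omega⟩ := Fin.ext (by simp only; omega)
      rw [hidx2, what_diag q hq τ γj hγj i hi]
    · rw [if_neg (fun h => ha0 (by have := congrArg Fin.val h; simpa using this)), if_neg ha0]
  · by_cases h : a = i - 1 ∧ i = q + 1
    · obtain ⟨rfl, hi1⟩ := h
      rw [if_pos (by omega), if_pos hi1, mul_one, if_pos ⟨rfl, hi1⟩]
      exact congrArg (γ · (Fin.last s)) (Fin.ext (by simp only; omega))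
    · rw [if_neg h]
      by_cases hc : i - 1 - a = 0
      · rw [if_pos hc, if_neg (by omega), mul_zero]
      · rw [if_neg hc, mul_zero]

omit hτrow in
/-- **Type-2 words on the chart letters**: for `i < s`, `b < s − 1 − i`,
`(A^i ŵ A^b Ê A^{s−2−i−b})_{0,s−1} = [i = 0 ∧ b = 0]·τ_{00}`. [this file] -/
theorem word2_eval (i b : ℕ) (hi : i < s) (hb : b < s - 1 - i) :
    (A ^ i * (vecMulVec (Pi.single (Fin.last s) (1 : ℂ)) (Pi.single (⟨q + 1, by omega⟩ : Fin (s + 1)) (1 : ℂ)) + τ + γj) *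
        (A ^ b * (vecMulVec (Pi.single (0 : Fin (s + 1)) (1 : ℂ)) (Pi.single (⟨1, by omega⟩ : Fin (s + 1)) (1 : ℂ)) + γ) *
          A ^ (s - 1 - i - 1 - b))) 0 ⟨s - 1, by omega⟩ =
      if i = 0 ∧ b = 0 then τ 0 0 else 0 := by
  have hyω : (⟨i + b + 1, by omega⟩ : Fin (s + 1)) ≠ Fin.last s := fun h => by
    have := congrArg Fin.val h; simp at this; omega
  rw [word2_apply A hA _ _ i b (s - 1 - i - 1 - b) (by omega) hs, Matrix.mul_add, Matrix.add_apply,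
    mul_shift_pow_mul_unit01_apply hs A hA, mul_shift_pow_mul_colLast_apply A γ _ hγ b _ _ hyω, add_zero]
  by_cases h : i = 0 ∧ b = 0
  · obtain ⟨rfl, rfl⟩ := h
    rw [if_pos ⟨Fin.ext (by simp), rfl⟩, if_pos ⟨rfl, rfl⟩]
    have e0 : (⟨0, by omega⟩ : Fin (s + 1)) = 0 := rfl
    rw [e0, what_zero_zero q hq τ γj hγj]
  · rw [if_neg h, if_neg]
    rintro ⟨h1, h2⟩
    have := congrArg Fin.val h1
    simp at this
    exact h ⟨by omega, h2⟩

/-! ## §4 The (E2) identity -/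

/-- ★★ **(E2), evaluated** (port map L2.4 / (D)).  With `ŵ = E_{ω,q+1} + τ + γ_{q+1}` (`τ` with zero row `ω`, `γ_{q+1}` in column `ω`) and
`Ê = E_{01} + γ` (`γ` in column `ω`), `q + 2 ≤ s`: the sum of ALL words in `A, Ê, ŵ` with exactly one `Ê` and one `ŵ` (the `[x¹z¹]`-part of
`(A + zÊ + xŵ)^s`, in the shape of eng-2 g3's ✓ `mixed_eq_zero` with `p = s`, `E = Ê`, `W = ŵ`), read at the entry `(0, s−1)`, equals `γ_{q,ω} + tr τ`.
The only contributing words: `E_{01}·A^{i−1}·τ·A^{s−1−i}` (value `τ_{ii}`, `1 ≤ i ≤ s−1`), `τ·E_{01}·A^{s−2}` (value `τ_{00}`), and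
`A^q·γ·E_{ω,q+1}·A^{s−2−q}` (value `γ_{q,ω} = g_q`); `tr τ` collects the diagonal since `τ_{ωω} = 0`.  With ✓ `mixed_eq_zero` (the sum is `0`
in a space on which `Z^s = 0`) and the chart's `tr τ = 0`: **`g_q = 0`**, i.e. (E2) of Q1-PROOF §2 in the kernel, for every `s`. [this file] -/
theorem E2_identity :
    (∑ i ∈ Finset.range s,
      ((∑ a ∈ Finset.range i, A ^ a * (vecMulVec (Pi.single (0 : Fin (s + 1)) (1 : ℂ)) (Pi.single (⟨1, by omega⟩ : Fin (s + 1)) (1 : ℂ)) + γ) *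
          A ^ (i - 1 - a)) * (vecMulVec (Pi.single (Fin.last s) (1 : ℂ)) (Pi.single (⟨q + 1, by omega⟩ : Fin (s + 1)) (1 : ℂ)) + τ + γj) *
          A ^ (s - 1 - i) +
        A ^ i * (vecMulVec (Pi.single (Fin.last s) (1 : ℂ)) (Pi.single (⟨q + 1, by omega⟩ : Fin (s + 1)) (1 : ℂ)) + τ + γj) *
          ∑ b ∈ Finset.range (s - 1 - i), A ^ b * (vecMulVec (Pi.single (0 : Fin (s + 1)) (1 : ℂ)) (Pi.single (⟨1, by omega⟩ : Fin (s + 1)) (1 : ℂ)) + γ) *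
            A ^ (s - 1 - i - 1 - b))) 0 ⟨s - 1, by omega⟩ =
      γ ⟨q, by omega⟩ (Fin.last s) + Matrix.trace τ := by
  -- the diagonal of `τ` as a function on `ℕ`
  set g : ℕ → ℂ := fun i => if h : i < s then τ ⟨i, by omega⟩ ⟨i, by omega⟩ else 0 with hg
  -- per-`i` evaluation: type-1 words, type-2 words
  have h1 : ∀ i, i < s →
      ∑ a ∈ Finset.range i, (A ^ a * (vecMulVec (Pi.single (0 : Fin (s + 1)) (1 : ℂ)) (Pi.single (⟨1, by omega⟩ : Fin (s + 1)) (1 : ℂ)) + γ) *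
          A ^ (i - 1 - a) * (vecMulVec (Pi.single (Fin.last s) (1 : ℂ)) (Pi.single (⟨q + 1, by omega⟩ : Fin (s + 1)) (1 : ℂ)) + τ + γj) *
          A ^ (s - 1 - i)) 0 ⟨s - 1, by omega⟩ =
        (if 0 < i then g i else 0) + (if i = q + 1 then γ ⟨q, by omega⟩ (Fin.last s) else 0) := by
    intro i hi
    rw [Finset.sum_congr rfl fun a ha => word1_eval hs A hA q hq τ γj γ hτrow hγj hγ i a hi (Finset.mem_range.1 ha),
      Finset.sum_add_distrib, Finset.sum_ite_eq' (Finset.range i) 0]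
    congr 1
    · rw [hg]
      simp only [Finset.mem_range, dif_pos hi]
    · by_cases hiq : i = q + 1
      · rw [if_pos hiq, Finset.sum_eq_single (i - 1)]
        · rw [if_pos ⟨rfl, hiq⟩]
        · intro a _ ha
          rw [if_neg (fun h => ha h.1)]
        · intro h
          exact absurd (Finset.mem_range.2 (by omega)) h
      · rw [if_neg hiq]
        exact Finset.sum_eq_zero fun a _ => by rw [if_neg (fun h => hiq h.2)]
  have h2 : ∀ i, i < s →
      ∑ b ∈ Finset.range (s - 1 - i), (A ^ i * (vecMulVec (Pi.single (Fin.last s) (1 : ℂ)) (Pi.single (⟨q + 1, by omega⟩ : Fin (s + 1)) (1 : ℂ)) + τ + γj) *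
          (A ^ b * (vecMulVec (Pi.single (0 : Fin (s + 1)) (1 : ℂ)) (Pi.single (⟨1, by omega⟩ : Fin (s + 1)) (1 : ℂ)) + γ) *
            A ^ (s - 1 - i - 1 - b))) 0 ⟨s - 1, by omega⟩ =
        if i = 0 then τ 0 0 else 0 := by
    intro i hi
    rw [Finset.sum_congr rfl fun b hb => word2_eval hs A hA q hq τ γj γ hγj hγ i b hi (Finset.mem_range.1 hb)]
    by_cases hi0 : i = 0
    · subst hi0
      rw [if_pos rfl, Finset.sum_eq_single 0]
      · rw [if_pos ⟨rfl, rfl⟩]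
      · intro b _ hb
        rw [if_neg (fun h => hb h.2)]
      · intro h
        exact absurd (Finset.mem_range.2 (by omega)) h
    · rw [if_neg hi0]
      exact Finset.sum_eq_zero fun b _ => by rw [if_neg (fun h => hi0 h.1)]
  have hI : ∀ i ∈ Finset.range s,
      (((∑ a ∈ Finset.range i, A ^ a * (vecMulVec (Pi.single (0 : Fin (s + 1)) (1 : ℂ)) (Pi.single (⟨1, by omega⟩ : Fin (s + 1)) (1 : ℂ)) + γ) *
          A ^ (i - 1 - a)) * (vecMulVec (Pi.single (Fin.last s) (1 : ℂ)) (Pi.single (⟨q + 1, by omega⟩ : Fin (s + 1)) (1 : ℂ)) + τ + γj) *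
          A ^ (s - 1 - i) +
        A ^ i * (vecMulVec (Pi.single (Fin.last s) (1 : ℂ)) (Pi.single (⟨q + 1, by omega⟩ : Fin (s + 1)) (1 : ℂ)) + τ + γj) *
          ∑ b ∈ Finset.range (s - 1 - i), A ^ b * (vecMulVec (Pi.single (0 : Fin (s + 1)) (1 : ℂ)) (Pi.single (⟨1, by omega⟩ : Fin (s + 1)) (1 : ℂ)) + γ) *
            A ^ (s - 1 - i - 1 - b)) 0 ⟨s - 1, by omega⟩) =
        g i + (if i = q + 1 then γ ⟨q, by omega⟩ (Fin.last s) else 0) := by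
    intro i hi'
    have hi := Finset.mem_range.1 hi'
    rw [Matrix.add_apply, Finset.sum_mul, Finset.sum_mul, Matrix.sum_apply, Matrix.mul_sum, Matrix.sum_apply, h1 i hi, h2 i hi]
    by_cases hi0 : i = 0
    · subst hi0
      rw [if_neg (lt_irrefl 0), if_pos rfl, zero_add, hg]
      simp only [dif_pos hi]
      have e0 : (⟨0, by omega⟩ : Fin (s + 1)) = 0 := rfl
      rw [e0]
      ring
    · rw [if_pos (Nat.pos_of_ne_zero hi0), if_neg hi0, add_zero]
  rw [Matrix.sum_apply, Finset.sum_congr rfl hI, Finset.sum_add_distrib, Finset.sum_ite_eq', if_pos (Finset.mem_range.2 (by omega)),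
    add_comm]
  congr 1
  -- `Σ_{i<s} τ_{ii} = tr τ` since `τ_{ωω} = 0`
  rw [Matrix.trace]
  simp only [Matrix.diag_apply]
  rw [Fin.sum_univ_castSucc, hτrow, add_zero, ← Fin.sum_univ_eq_sum_range]
  refine Finset.sum_congr rfl fun i _ => ?_
  rw [hg]
  simp only [dif_pos i.isLt]
  congr 1

end Chart

end Summit.ValiantsHypothesis.ValiantsHypothesis.Theorems.GrenetZeon.HeavyTopE2Identity
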